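import Summits.BirchSwinnertonDyer.BirchSwinnertonDyer.Theorems.RamifiedHeegnerPairLeafSigmaStarTightData
import HarnessLib

/-!
# Σ★″ (`LeafSigmaStarDivisibilityAtThreeOptimalOffRows`, item 27493) — NEGATIVE lemma: the budget clause is load-bearing
# (standing disprover cdisprove-27493 g0; `--supports stmt-BirchSwinnertonDyer-27493`; BSD is proved or disproved for no curve)

Any proof of Σ★″ must USE the bound `s' ≤ ord₃ ∏c_ℓ(E) + v₃|c|`: the statement with that clause deleted
(body otherwise VERBATIM) asserts at `n = 1` (square-free, no prime factor, Kolyvagin guard vacuous) that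
`P_1 = y_K ∈ 3^{s'} E(K[1])` for EVERY `s'`, impossible for a non-torsion point of the finitely generated
group `E(K[1])`. Kernel-checked modulo Shimura reciprocity at conductor `1` (`hrec`), Darmon's Thm. 3.6
(`h36`, existence of a conductor-`1` datum) as named facts, and the existence of one Σ★″-frame (displayed
`∃`-hypothesis, print-grade: every residual `r_an = 1` leaf class with an odd Heegner field supplies one).
Theorems only — no definition, no named fact, no `sorry`. Where the threshold lies (`ord₃ [E(K):ℤ y_K]`,
McCallum Lemma 5.1) is the sibling file `IndexThreshold.lean`.
References: [McCallumLMS1991] §5 Lemma 5.1; [GrossLMS1991] §4; [Darmon2004] Thm. 3.6.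
-/

-- D-0017: single-problem summit, so `Summit.BirchSwinnertonDyer.BirchSwinnertonDyer.…` repeats a namespace BY DESIGN.
set_option linter.dupNamespace false
set_option autoImplicit false

noncomputable section

open scoped Classical NumberField

open WeierstrassCurve NumberField IsDedekindDomain Literature Literature.NumberTheory.EllipticCurves
  Literature.NumberTheory.EllipticCurves.ModularForms
  Literature.NumberTheory.EllipticCurves.Rank1Residual
  Literature.NumberTheory.EllipticCurves.Rank1Residual.Typed
  Summit.BirchSwinnertonDyer.Rank1Residual
  Summit.BirchSwinnertonDyer.Rank1Residual.Additive
  Summit.BirchSwinnertonDyer.Rank1Residual.X11b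
  Summit.BirchSwinnertonDyer.BirchSwinnertonDyer.Theses.RamifiedHeegnerPair
  Summit.BirchSwinnertonDyer.BirchSwinnertonDyer.Theorems

namespace Summit.BirchSwinnertonDyer.BirchSwinnertonDyer.Theorems.LeafSigmaStarDivisibilityAtThreeOptimalOffRowsNegative

section Frame

-- `K : Type`: the tree's ring-class class field theory is universe `0`.
variable {K : Type} [Field K] [NumberField K]
variable {N : ℕ} [NeZero N] {W : WeierstrassCurve ℚ} [W.IsElliptic] {Dt : ModularParametrizationData W N} {β : ℤ}
  {ι : K →+* ℂ}

/-- **A non-torsion `P_1` is not `3^{s'}`-divisible in `E(K[1])` for some `s'`.** `K[1]` is a number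
field (`finiteDimensional_and_isGalois_ringClassField`, `NumberField.of_module_finite`), so `E(K[1])` is finitely generated (Mordell–Weil,
`module_finite_point_holds`) and a non-torsion element has a maximal `3`-power divisor
(`exists_pow_smul_eq_and_forall_ne`, McCallum Lemma 5.1's `M₀ < ∞`). No image hypothesis, no
parity, no budget. [cite: McCallumLMS1991, §5 Lemma 5.1 (p. 303)] -/
theorem exists_not_pDiv_one (hK : IsImaginaryQuadratic K) (d₁ : KolyvaginHeegnerData Dt β ι 1)
    (h : ¬ IsOfFinAddOrder d₁.derivedPoint) : ∃ s' : ℕ, ¬ Three.Koly.PDiv d₁ 3 s' := by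
  haveI := (finiteDimensional_and_isGalois_ringClassField hK ι one_ne_zero).1
  haveI : NumberField (ringClassField K ι 1) := NumberField.of_module_finite K _
  haveI : Module.Finite ℤ (W.baseChange (ringClassField K ι 1)).toAffine.Point := by
    convert (W.baseChange (ringClassField K ι 1)).module_finite_point_holds
  obtain ⟨M₀, -, -, hmax⟩ := exists_pow_smul_eq_and_forall_ne h (p := 3) (by norm_num)
  exact ⟨M₀ + 1, fun ⟨Q, hQ⟩ ↦ hmax Q (by rw [← natCast_zsmul]; exact hQ)⟩

/-- **At a Heegner frame, `P_1` is not infinitely `3`-divisible.** For `P ∈ E(K)` non-torsion with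
complex point `heegnerPointComplex Dt H` under `ι` and ANY Kolyvagin–Heegner datum `d₁` of conductor `1`
on `(Dt, H.β, ι)`: `P_1 = d₁.derivedPoint` is the image of `P` (Shimura reciprocity at conductor `1`,
`hrec`, named fact NOT discharged; tree `KolyvaginBottom.isOfFinAddOrder_derivedPoint_one_iff`), hence
non-torsion, hence `∃ s', ¬ 3^{s'} ∣ P_1`. CONDITIONAL on `hrec`. [cite: GrossLMS1991, §4 (P_1 = y_K)]
[cite: McCallumLMS1991, §5 Lemma 5.1 (p. 303)] -/
theorem exists_not_pDiv_one_of_frame (hrec : heegnerPointOfConductor_one_galoisConj N W K)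
    (hK : IsImaginaryQuadratic K) (hHN : SatisfiesHeegnerHypothesis N K) {H : HeegnerDatum N (NumberField.discr K)}
    {P : (W.baseChange K).toAffine.Point}
    (hP : WeierstrassCurve.Affine.Point.map (W' := W) ι.toRatAlgHom P = heegnerPointComplex Dt H)
    (hPinf : ¬ IsOfFinAddOrder P) (d₁ : KolyvaginHeegnerData Dt H.β ι 1) :
    ∃ s' : ℕ, ¬ Three.Koly.PDiv d₁ 3 s' :=
  exists_not_pDiv_one hK d₁ fun h ↦
    hPinf ((KolyvaginBottom.isOfFinAddOrder_derivedPoint_one_iff hrec hK hHN hP d₁ rfl).mp h)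

end Frame

/-- **`Σ★″_false_without_budget`: any proof of Σ★″ must use the budget clause.** Given Shimura
reciprocity at conductor `1` (`hrec`) and Darmon's Thm. 3.6 (`h36`, a Kolyvagin–Heegner datum of
conductor `1` on every frame, tree `nonempty_kolyvaginHeegnerData_one_of_darmon36`) as named facts, and ONE
Σ★″-frame (`hF`, the binders of Σ★″ up to `Odd d_K`, print-grade), the registered text of
`LeafSigmaStarDivisibilityAtThreeOptimalOffRows` with the clause
`s' ≤ padicValNat 3 W.tamagawaProduct + padicValNat 3 Dt.c.natAbs` DELETED (everything else verbatim) is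
FALSE: at `n = 1` it gives `3^{s'} ∣ P_1` for every `s'`, against `exists_not_pDiv_one_of_frame`.
CONDITIONAL on `hrec`, `h36`, `hF`; BSD is proved or disproved for no curve.
[cite: McCallumLMS1991, §5 Lemma 5.1 (p. 303)] [cite: Darmon2004, Thm. 3.6 and §3.7 (PDF pp. 44, 49)] -/
theorem leafSigmaStar_false_without_budget
    (hrec : ∀ (N : ℕ) [NeZero N] (W : WeierstrassCurve ℚ) (K : Type) [Field K] [NumberField K],
      heegnerPointOfConductor_one_galoisConj N W K)
    (h36 : ∀ (N : ℕ) [NeZero N] (W : WeierstrassCurve ℚ) (K : Type) [Field K] [NumberField K],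
      phi_heegnerTau_mem_range_map_singularModuliField N W K)
    (hF : ∃ (W : WeierstrassCurve ℚ) (_ : W.IsElliptic) (_ : W.IsGloballyMinimal) (N : ℕ) (_ : NeZero N) (K : Type)
      (_ : Field K) (_ : NumberField K) (Dt : ModularParametrizationData W N) (H : HeegnerDatum N (NumberField.discr K))
      (ι : K →+* ℂ) (P : (W.baseChange K).toAffine.Point),
      ¬ W.HasCM ∧ Addv W 3 ∧ SubGss W 3 ∧ W.conductorNorm ℤ = N ∧
      (∀ z ∈ Dt.L.lattice, ∃ w ∈ periodLattice Dt.f, z = Dt.c * w) ∧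
      ¬ ((∃ (q : ℕ) (_ : Fact q.Prime), q ∣ N ∧ ¬ q ^ 2 ∣ N ∧
            padicValNat 3 W.tamagawaProduct ≤ padicValNat 3 ((W.baseChange ℚ_[q]).localTamagawaNumber ℤ_[q])) ∧
          (∀ (q' : ℕ) [Fact q'.Prime], q' ∣ N → 3 ∣ (W.baseChange ℚ_[q']).localTamagawaNumber ℤ_[q'] → ¬ q' ^ 2 ∣ N)) ∧
      IsImaginaryQuadratic K ∧ SatisfiesHeegnerHypothesis N K ∧
      (WeierstrassCurve.Affine.Point.map ι.toRatAlgHom) P = heegnerPointComplex Dt H ∧ ¬ IsOfFinAddOrder P ∧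
      Odd (NumberField.discr K)) :
    ¬ (∀ (W : WeierstrassCurve ℚ) [W.IsElliptic] [W.IsGloballyMinimal] (N : ℕ) [NeZero N] (K : Type) [Field K]
        [NumberField K] (Dt : ModularParametrizationData W N) (H : HeegnerDatum N (NumberField.discr K)) (ι : K →+* ℂ)
        (P : (W.baseChange K).toAffine.Point), ¬ W.HasCM → Addv W 3 → SubGss W 3 → W.conductorNorm ℤ = N →
        (∀ z ∈ Dt.L.lattice, ∃ w ∈ periodLattice Dt.f, z = Dt.c * w) →
        ¬ ((∃ (q : ℕ) (_ : Fact q.Prime), q ∣ N ∧ ¬ q ^ 2 ∣ N ∧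
              padicValNat 3 W.tamagawaProduct ≤ padicValNat 3 ((W.baseChange ℚ_[q]).localTamagawaNumber ℤ_[q])) ∧
            (∀ (q' : ℕ) [Fact q'.Prime], q' ∣ N → 3 ∣ (W.baseChange ℚ_[q']).localTamagawaNumber ℤ_[q'] → ¬ q' ^ 2 ∣ N)) →
        IsImaginaryQuadratic K → SatisfiesHeegnerHypothesis N K →
        (WeierstrassCurve.Affine.Point.map ι.toRatAlgHom) P = heegnerPointComplex Dt H → ¬ IsOfFinAddOrder P →
        Odd (NumberField.discr K) → ∀ (s' : ℕ),
        ∀ (n : ℕ) (d : KolyvaginHeegnerData Dt H.β ι n), Squarefree n →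
        (∀ ℓ ∈ n.primeFactors, Zhang2014.IsKolyvaginPrime N W K 3 ℓ ∧ s' ≤ Zhang2014.kolyvaginIndex W 3 ℓ) →
        Three.Koly.PDiv d 3 s') := by
  intro hS
  obtain ⟨W, _, _, N, _, K, _, _, Dt, H, ι, P, hCM, hAddv, hGss, hN, hOpt, hOff, hK, hHN, hP, hPinf, hodd⟩ := hF
  obtain ⟨d₁⟩ := nonempty_kolyvaginHeegnerData_one_of_darmon36 (h36 _ W K) hK Dt H.β ι H.dvd_sq_sub
  obtain ⟨s', hs'⟩ := exists_not_pDiv_one_of_frame (hrec _ W K) hK hHN hP hPinf d₁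
  exact hs' (hS W N K Dt H ι P hCM hAddv hGss hN hOpt hOff hK hHN hP hPinf hodd s' 1 d₁ squarefree_one
    (fun ℓ hℓ ↦ absurd hℓ (by simp)))

end Summit.BirchSwinnertonDyer.BirchSwinnertonDyer.Theorems.LeafSigmaStarDivisibilityAtThreeOptimalOffRowsNegative

end
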